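import Literature.Analysis.ValidatedNumerics.TaylorModelIntegralCert3D
import HarnessLib

/-!
# Adaptive (kd-tree) certificates for triple integrals over boxes

Trunk T-ANA (Analysis/ValidatedNumerics); namespace `Literature.Analysis.ValidatedNumerics.PolyMP`.
Sequel of `TaylorModelIntegralCert3D.lean` (the box estimate `abs_integral3_sub_integ3Q_le`, the box rule `boxEnclG3`,
the expression language `BExpr3` with `BExpr3.model` / `tmem3_model`) and the 3-D analogue of
`TaylorModelIntegralCert2DAdaptive.lean`.  The uniform `n × m × o` grid of `TaylorModelIntegralCert3D` costs `n·m·o`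
kernel obligations of one size and one degree; verified quadrature in the Taylor-model literature is adaptive over a
PARTITION of the domain box (Makino–Berz 2003, Algorithm 2; Berz–Makino 1999, Sect. 2, where the point of Taylor-model
quadrature is precisely that few large boxes suffice in dimension `d ≥ 3`; Mahboubi–Melquiond–Sibut-Pinote 2016, Sect. 3.3:
recursive splitting, enclosures of the pieces added).  This file makes the partition a certificate datum:

* `Box3Q` — a rational box; `KdTree3` — leaves carry their own parameters `EPrm` and claimed enclosure `J : MI`, inner nodes
  split the current box at `x = c`, `y = c` or `z = c`; `KdTree3.leaves`, `KdTree3.total`, `KdTree3.size`;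
* **Part A, generic in a box modeller** `Ψ : (h k l cx cy cz : ℚ) → EPrm → IPoly3 × Bool`: the leaf rule `leafEncl3`
  (= `boxEnclG3` at the leaf's own centre and half-widths; flag also requiring `x0 ≤ x1`, `y0 ≤ y1`, `z0 ≤ z1`), its
  soundness in absolute coordinates, the kernel obligations `leafCheckG3 … i` (ONE `decide` per leaf), the final obligation
  `treeCheckG3`, and **`integral_bounds_of_leafCheckG3`**, by structural induction on the tree (additivity across an
  `x`-split; across a `y`-split on every `x`-section; across a `z`-split on every `(x, y)`-section, pushed out through the
  two outer integrals);
* **Part B** for `BExpr3` integrands: `leafCheck3E` / `treeCheck3E` / **`integral_bounds_of_leafCheck3E (hleaf) (ht) :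
  lo ≤ ∫_{x0}^{x1} ∫_{y0}^{y1} ∫_{z0}^{z1} E(x, y, z) dz dy dx ≤ hi`** with no side hypotheses;
* **Part C** — the refinement heuristic `kdRefine3` (bisect the longest side while rejected or too wide; soundness-free).

Problem-independent; no facts, no axioms; all certificate data computable over `ℤ`.

## References

* K. Makino, M. Berz, *Taylor models and other validated functional inclusion methods*, Int. J. Pure Appl. Math. 4
  (2003) 379–456, Algorithm 2. [cite: MakinoBerz2003, Algorithm 2]
* M. Berz, K. Makino, *New methods for high-dimensional verified quadrature*, Reliable Computing 5 (1999) 13–22, Sect. 2.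
  [cite: BerzMakino1999, Sect. 2]
* A. Mahboubi, G. Melquiond, T. Sibut-Pinote, *Formally verified approximations of definite integrals*, ITP 2016, LNCS 9807,
  274–289, Sect. 3.3. [cite: MahboubiMelquiondSibutpinote2016, Sect. 3.3]
* Additivity of the interval integral over adjacent intervals and translation invariance (Mathlib). [folklore]
-/

open MeasureTheory intervalIntegral Set
open scoped Interval

namespace Literature.Analysis.ValidatedNumerics

namespace PolyMP

open Literature.Analysis.ValidatedNumerics.NumericsMP
open Literature.Analysis.ValidatedNumerics.ExpPoly (Poly)
open Literature.Analysis.ValidatedNumerics.ExpPoly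

/-! ### Boxes and kd-trees -/

/-- A rational box `[x0, x1] × [y0, y1] × [z0, z1]`. [cite: MakinoBerz2003, Algorithm 2] -/
structure Box3Q where
  /-- left abscissa -/
  x0 : ℚ
  /-- right abscissa -/
  x1 : ℚ
  /-- lower ordinate -/
  y0 : ℚ
  /-- upper ordinate -/
  y1 : ℚ
  /-- lower applicate -/
  z0 : ℚ
  /-- upper applicate -/
  z1 : ℚ

/-- **Adaptive certificate data in 3-D**: a kd-tree over a box; leaves carry parameters and CLAIMED enclosure (scaled by
`S`), inner nodes split at `x = c`, `y = c` or `z = c`.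
[cite: MahboubiMelquiondSibutpinote2016, Sect. 3.3] [cite: MakinoBerz2003, Algorithm 2] -/
inductive KdTree3 : Type
  /-- a leaf box, modelled with parameters `P`, claimed enclosure `J` -/
  | leaf (P : EPrm) (J : MI) : KdTree3
  /-- split at `x = c` -/
  | splitX (c : ℚ) (L R : KdTree3) : KdTree3
  /-- split at `y = c` -/
  | splitY (c : ℚ) (L R : KdTree3) : KdTree3
  /-- split at `z = c` -/
  | splitZ (c : ℚ) (L R : KdTree3) : KdTree3

namespace KdTree3

/-- The leaf boxes of a tree laid over `B`, in order, with parameters and claims.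
[cite: MahboubiMelquiondSibutpinote2016, Sect. 3.3] -/
def leaves : KdTree3 → Box3Q → List (Box3Q × EPrm × MI)
  | leaf P J, B => [(B, P, J)]
  | splitX c L R, B => leaves L ⟨B.x0, c, B.y0, B.y1, B.z0, B.z1⟩ ++ leaves R ⟨c, B.x1, B.y0, B.y1, B.z0, B.z1⟩
  | splitY c L R, B => leaves L ⟨B.x0, B.x1, B.y0, c, B.z0, B.z1⟩ ++ leaves R ⟨B.x0, B.x1, c, B.y1, B.z0, B.z1⟩
  | splitZ c L R, B => leaves L ⟨B.x0, B.x1, B.y0, B.y1, B.z0, c⟩ ++ leaves R ⟨B.x0, B.x1, B.y0, B.y1, c, B.z1⟩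

/-- The sum of the claimed leaf enclosures. [cite: MahboubiMelquiondSibutpinote2016, Sect. 3.3] -/
def total : KdTree3 → MI
  | leaf _ J => J
  | splitX _ L R => MI.add (total L) (total R)
  | splitY _ L R => MI.add (total L) (total R)
  | splitZ _ L R => MI.add (total L) (total R)

/-- Number of leaves. [cite: MahboubiMelquiondSibutpinote2016, Sect. 3.3] -/
def size : KdTree3 → ℕ
  | leaf _ _ => 1
  | splitX _ L R => size L + size R
  | splitY _ L R => size L + size R
  | splitZ _ L R => size L + size R

/-- [cite: MahboubiMelquiondSibutpinote2016, Sect. 3.3] -/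
theorem length_leaves : ∀ (t : KdTree3) (B : Box3Q), (t.leaves B).length = t.size
  | leaf _ _, _ => rfl
  | splitX c L R, B => by simp [leaves, size, length_leaves L, length_leaves R]
  | splitY c L R, B => by simp [leaves, size, length_leaves L, length_leaves R]
  | splitZ c L R, B => by simp [leaves, size, length_leaves L, length_leaves R]

end KdTree3

/-! ### Part A. Leaf rule and certificate, generic in the box modeller -/

/-- **The leaf rule**: `boxEnclG3` at the leaf's own centre and half-widths for a modeller `Ψ h k l cx cy cz P`; the flag
also requires `x0 ≤ x1`, `y0 ≤ y1`, `z0 ≤ z1`. [cite: MakinoBerz2003, Algorithm 2] -/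
def leafEncl3 (S : ℕ) (Ψ : ℚ → ℚ → ℚ → ℚ → ℚ → ℚ → EPrm → IPoly3 × Bool) (B : Box3Q) (P : EPrm) : MI × Bool :=
  let h := (B.x1 - B.x0) / 2
  let k := (B.y1 - B.y0) / 2
  let l := (B.z1 - B.z0) / 2
  let b := boxEnclG3 S h k l (fun cx cy cz => Ψ h k l cx cy cz P)
    ((B.x0 + B.x1) / 2) ((B.y0 + B.y1) / 2) ((B.z0 + B.z1) / 2)
  (b.1, b.2 && decide (B.x0 ≤ B.x1) && decide (B.y0 ≤ B.y1) && decide (B.z0 ≤ B.z1))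

/-- **Soundness shape of a 3-D modeller**. [cite: MakinoBerz2003, Algorithm 2] -/
def ModelSound3 (S : ℕ) (f : ℝ → ℝ → ℝ → ℝ) (Ψ : ℚ → ℚ → ℚ → ℚ → ℚ → ℚ → EPrm → IPoly3 × Bool) : Prop :=
  ∀ (h k l cx cy cz : ℚ) (P : EPrm), 0 ≤ h → 0 ≤ k → 0 ≤ l → (Ψ h k l cx cy cz P).2 = true →
    TMem3 S h k l (fun u v w => f ((cx : ℝ) + u) ((cy : ℝ) + v) ((cz : ℝ) + w)) (Ψ h k l cx cy cz P).1

/-- What a sound enclosure over a 3-D box provides downstream. [folklore] -/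
private def BoxClaim3 (S : ℕ) (f : ℝ → ℝ → ℝ → ℝ) (B : Box3Q) (J : MI) : Prop :=
  MI.mem S (∫ x in (B.x0 : ℝ)..B.x1, ∫ y in (B.y0 : ℝ)..B.y1, ∫ z in (B.z0 : ℝ)..B.z1, f x y z) J ∧
    IntervalIntegrable (fun x => ∫ y in (B.y0 : ℝ)..B.y1, ∫ z in (B.z0 : ℝ)..B.z1, f x y z) volume (B.x0 : ℝ) B.x1 ∧
    (∀ x : ℝ, (B.x0 : ℝ) ≤ x → x ≤ B.x1 →
      IntervalIntegrable (fun y => ∫ z in (B.z0 : ℝ)..B.z1, f x y z) volume (B.y0 : ℝ) B.y1) ∧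
    (∀ x y : ℝ, (B.x0 : ℝ) ≤ x → x ≤ B.x1 → (B.y0 : ℝ) ≤ y → y ≤ B.y1 →
      IntervalIntegrable (fun z => f x y z) volume (B.z0 : ℝ) B.z1) ∧
    B.x0 ≤ B.x1 ∧ B.y0 ≤ B.y1 ∧ B.z0 ≤ B.z1

/-- **Soundness of the leaf rule** in absolute coordinates. [folklore] -/
private theorem leafEncl3_sound {S : ℕ} (hS : 0 < S) {f : ℝ → ℝ → ℝ → ℝ}
    (hf : Measurable fun z : ℝ × ℝ × ℝ => f z.1 z.2.1 z.2.2)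
    {Ψ : ℚ → ℚ → ℚ → ℚ → ℚ → ℚ → EPrm → IPoly3 × Bool} (hΨ : ModelSound3 S f Ψ) (B : Box3Q) (P : EPrm)
    (hok : (leafEncl3 S Ψ B P).2 = true) : BoxClaim3 S f B (leafEncl3 S Ψ B P).1 := by
  simp only [leafEncl3, boxEnclG3, Bool.and_eq_true, decide_eq_true_eq] at hok ⊢
  obtain ⟨⟨⟨hacc, hx⟩, hy⟩, hz⟩ := hok
  set h : ℚ := (B.x1 - B.x0) / 2 with hh
  set k : ℚ := (B.y1 - B.y0) / 2 with hk
  set l : ℚ := (B.z1 - B.z0) / 2 with hl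
  set cx : ℚ := (B.x0 + B.x1) / 2 with hcx
  set cy : ℚ := (B.y0 + B.y1) / 2 with hcy
  set cz : ℚ := (B.z0 + B.z1) / 2 with hcz
  have h0 : 0 ≤ h := by rw [hh]; linarith
  have k0 : 0 ≤ k := by rw [hk]; linarith
  have l0 : 0 ≤ l := by rw [hl]; linarith
  have hT := hΨ h k l cx cy cz P h0 k0 l0 hacc
  have hm : Measurable fun z : ℝ × ℝ × ℝ => f ((cx : ℝ) + z.1) ((cy : ℝ) + z.2.1) ((cz : ℝ) + z.2.2) :=
    hf.comp ((measurable_const.add measurable_fst).prodMk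
      ((measurable_const.add measurable_snd.fst).prodMk (measurable_const.add measurable_snd.snd)))
  obtain ⟨hest, hI, hσ, hτ⟩ :=
    abs_integral3_sub_integ3Q_le hS h0 k0 l0 hm hT (midRows3 S (Ψ h k l cx cy cz P).1)
  have ex0 : (cx : ℝ) + -(h : ℝ) = (B.x0 : ℝ) := by rw [hcx, hh]; push_cast; ring
  have ex1 : (cx : ℝ) + (h : ℝ) = (B.x1 : ℝ) := by rw [hcx, hh]; push_cast; ring
  have ey0 : (cy : ℝ) + -(k : ℝ) = (B.y0 : ℝ) := by rw [hcy, hk]; push_cast; ring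
  have ey1 : (cy : ℝ) + (k : ℝ) = (B.y1 : ℝ) := by rw [hcy, hk]; push_cast; ring
  have ez0 : (cz : ℝ) + -(l : ℝ) = (B.z0 : ℝ) := by rw [hcz, hl]; push_cast; ring
  have ez1 : (cz : ℝ) + (l : ℝ) = (B.z1 : ℝ) := by rw [hcz, hl]; push_cast; ring
  have einner : ∀ u v : ℝ, (∫ w in (-(l : ℝ))..l, f ((cx : ℝ) + u) ((cy : ℝ) + v) ((cz : ℝ) + w)) =
      ∫ z in (B.z0 : ℝ)..B.z1, f ((cx : ℝ) + u) ((cy : ℝ) + v) z := by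
    intro u v
    rw [intervalIntegral.integral_comp_add_left (fun z => f ((cx : ℝ) + u) ((cy : ℝ) + v) z) (cz : ℝ), ez0, ez1]
  simp_rw [einner] at hest hI hσ
  have emid : ∀ u : ℝ, (∫ v in (-(k : ℝ))..k, ∫ z in (B.z0 : ℝ)..B.z1, f ((cx : ℝ) + u) ((cy : ℝ) + v) z) =
      ∫ y in (B.y0 : ℝ)..B.y1, ∫ z in (B.z0 : ℝ)..B.z1, f ((cx : ℝ) + u) y z := by
    intro u
    rw [intervalIntegral.integral_comp_add_left (fun y => ∫ z in (B.z0 : ℝ)..B.z1, f ((cx : ℝ) + u) y z) (cy : ℝ),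
      ey0, ey1]
  simp_rw [emid] at hest hI
  have eouter : (∫ u in (-(h : ℝ))..h, ∫ y in (B.y0 : ℝ)..B.y1, ∫ z in (B.z0 : ℝ)..B.z1, f ((cx : ℝ) + u) y z) =
      ∫ x in (B.x0 : ℝ)..B.x1, ∫ y in (B.y0 : ℝ)..B.y1, ∫ z in (B.z0 : ℝ)..B.z1, f x y z := by
    rw [intervalIntegral.integral_comp_add_left
      (fun x => ∫ y in (B.y0 : ℝ)..B.y1, ∫ z in (B.z0 : ℝ)..B.z1, f x y z) (cx : ℝ), ex0, ex1]
  rw [eouter] at hest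
  refine ⟨?_, ?_, ?_, ?_, hx, hy, hz⟩
  · refine MI.mem_widen (mem_ofRat S _) ?_
    have hSr : (0 : ℝ) < S := by exact_mod_cast hS
    set Bd : ℤ := tabs3 S h k l (tsub3 (Ψ h k l cx cy cz P).1 (ratPoly3 S (midRows3 S (Ψ h k l cx cy cz P).1)))
      with hBd
    have h1 := mul_le_mul_of_nonneg_right hest hSr.le
    have h2 : (Bd : ℝ) / S * (2 * l) * (2 * k) * (2 * h) * S = (((Bd : ℚ) * (8 * h * k * l) : ℚ) : ℝ) := by
      push_cast; field_simp; ring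
    have h3 : (((Bd : ℚ) * (8 * h * k * l) : ℚ) : ℝ) ≤ (boxErr3 h k l Bd : ℝ) := by
      unfold boxErr3; exact_mod_cast Int.le_ceil _
    rw [h2] at h1
    exact h1.trans h3
  · have h1 := hI.comp_sub_right (cx : ℝ)
    have e0 : (fun x => ∫ y in (B.y0 : ℝ)..B.y1, ∫ z in (B.z0 : ℝ)..B.z1, f ((cx : ℝ) + (x - (cx : ℝ))) y z) =
        fun x => ∫ y in (B.y0 : ℝ)..B.y1, ∫ z in (B.z0 : ℝ)..B.z1, f x y z := by
      funext x; simp only [add_sub_cancel]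
    have ea : -(h : ℝ) + (cx : ℝ) = (B.x0 : ℝ) := by rw [← ex0]; ring
    have eb : (h : ℝ) + (cx : ℝ) = (B.x1 : ℝ) := by rw [← ex1]; ring
    rw [e0, ea, eb] at h1
    exact h1
  · intro x hx0 hx1
    have hu : |x - (cx : ℝ)| ≤ h := by
      rw [abs_le]; constructor <;> linarith [ex0, ex1]
    have h1 := (hσ (x - cx) hu).comp_sub_right (cy : ℝ)
    have e0 : (fun y => ∫ z in (B.z0 : ℝ)..B.z1, f ((cx : ℝ) + (x - (cx : ℝ))) ((cy : ℝ) + (y - (cy : ℝ))) z) =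
        fun y => ∫ z in (B.z0 : ℝ)..B.z1, f x y z := by
      funext y; simp only [add_sub_cancel]
    have ea : -(k : ℝ) + (cy : ℝ) = (B.y0 : ℝ) := by rw [← ey0]; ring
    have eb : (k : ℝ) + (cy : ℝ) = (B.y1 : ℝ) := by rw [← ey1]; ring
    rw [e0, ea, eb] at h1
    exact h1
  · intro x y hx0 hx1 hy0 hy1
    have hu : |x - (cx : ℝ)| ≤ h := by
      rw [abs_le]; constructor <;> linarith [ex0, ex1]
    have hv : |y - (cy : ℝ)| ≤ k := by
      rw [abs_le]; constructor <;> linarith [ey0, ey1]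
    have h1 := (hτ (x - cx) (y - cy) hu hv).comp_sub_right (cz : ℝ)
    have e0 : (fun z => f ((cx : ℝ) + (x - (cx : ℝ))) ((cy : ℝ) + (y - (cy : ℝ))) ((cz : ℝ) + (z - (cz : ℝ)))) =
        fun z => f x y z := by
      funext z; simp only [add_sub_cancel]
    have ea : -(l : ℝ) + (cz : ℝ) = (B.z0 : ℝ) := by rw [← ez0]; ring
    have eb : (l : ℝ) + (cz : ℝ) = (B.z1 : ℝ) := by rw [← ez1]; ring
    rw [e0, ea, eb] at h1
    exact h1

/-- Every leaf accepted and inside its claim. [cite: MahboubiMelquiondSibutpinote2016, Sect. 3.3] -/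
def leafClaimsOK3 (S : ℕ) (Ψ : ℚ → ℚ → ℚ → ℚ → ℚ → ℚ → EPrm → IPoly3 × Bool)
    (ls : List (Box3Q × EPrm × MI)) : Bool :=
  ls.all fun l =>
    let e := leafEncl3 S Ψ l.1 l.2.1
    e.2 && decide (l.2.2.lo ≤ e.1.lo) && decide (e.1.hi ≤ l.2.2.hi)

/-- **Soundness of a checked 3-D tree** (structural induction; `x`-split: additivity over adjacent intervals; `y`-split:
additivity on every `x`-section; `z`-split: additivity on every `(x, y)`-section, pushed through both outer integrals by
`integral_congr`). [folklore] -/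
private theorem tree3_sound {S : ℕ} (hS : 0 < S) {f : ℝ → ℝ → ℝ → ℝ}
    (hf : Measurable fun z : ℝ × ℝ × ℝ => f z.1 z.2.1 z.2.2)
    {Ψ : ℚ → ℚ → ℚ → ℚ → ℚ → ℚ → EPrm → IPoly3 × Bool} (hΨ : ModelSound3 S f Ψ) :
    ∀ (t : KdTree3) (B : Box3Q), leafClaimsOK3 S Ψ (t.leaves B) = true → BoxClaim3 S f B t.total
  | KdTree3.leaf P J, B, hok => by
      simp only [KdTree3.leaves, leafClaimsOK3, List.all_cons, List.all_nil, Bool.and_true, Bool.and_eq_true,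
        decide_eq_true_eq] at hok
      obtain ⟨⟨hacc, hlo⟩, hhi⟩ := hok
      obtain ⟨hm, hI, hσ, hτ, hx, hy, hz⟩ := leafEncl3_sound hS hf hΨ B P hacc
      refine ⟨⟨?_, ?_⟩, hI, hσ, hτ, hx, hy, hz⟩
      · exact le_trans (by exact_mod_cast hlo) hm.1
      · exact le_trans hm.2 (by exact_mod_cast hhi)
  | KdTree3.splitX c L R, B, hok => by
      simp only [KdTree3.leaves, leafClaimsOK3, List.all_append, Bool.and_eq_true] at hok
      obtain ⟨hmL, hIL, hσL, hτL, hxL, hyL, hzL⟩ := tree3_sound hS hf hΨ L ⟨B.x0, c, B.y0, B.y1, B.z0, B.z1⟩ hok.1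
      obtain ⟨hmR, hIR, hσR, hτR, hxR, hyR, hzR⟩ := tree3_sound hS hf hΨ R ⟨c, B.x1, B.y0, B.y1, B.z0, B.z1⟩ hok.2
      simp only at hmL hIL hσL hτL hxL hyL hzL hmR hIR hσR hτR hxR hyR hzR
      refine ⟨?_, hIL.trans hIR, ?_, ?_, hxL.trans hxR, hyL, hzL⟩
      · rw [KdTree3.total, ← intervalIntegral.integral_add_adjacent_intervals hIL hIR]
        exact MI.mem_add hmL hmR
      · intro x h0 h1
        rcases le_total x (c : ℝ) with hc | hc
        · exact hσL x h0 hc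
        · exact hσR x hc h1
      · intro x y h0 h1 g0 g1
        rcases le_total x (c : ℝ) with hc | hc
        · exact hτL x y h0 hc g0 g1
        · exact hτR x y hc h1 g0 g1
  | KdTree3.splitY c L R, B, hok => by
      simp only [KdTree3.leaves, leafClaimsOK3, List.all_append, Bool.and_eq_true] at hok
      obtain ⟨hmL, hIL, hσL, hτL, hxL, hyL, hzL⟩ := tree3_sound hS hf hΨ L ⟨B.x0, B.x1, B.y0, c, B.z0, B.z1⟩ hok.1
      obtain ⟨hmR, hIR, hσR, hτR, hxR, hyR, hzR⟩ := tree3_sound hS hf hΨ R ⟨B.x0, B.x1, c, B.y1, B.z0, B.z1⟩ hok.2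
      simp only at hmL hIL hσL hτL hxL hyL hzL hmR hIR hσR hτR hxR hyR hzR
      have hxx : (B.x0 : ℝ) ≤ B.x1 := by exact_mod_cast hxL
      have hsec : ∀ x : ℝ, (B.x0 : ℝ) ≤ x → x ≤ B.x1 →
          (∫ y in (B.y0 : ℝ)..c, ∫ z in (B.z0 : ℝ)..B.z1, f x y z) +
              ∫ y in (c : ℝ)..B.y1, ∫ z in (B.z0 : ℝ)..B.z1, f x y z =
            ∫ y in (B.y0 : ℝ)..B.y1, ∫ z in (B.z0 : ℝ)..B.z1, f x y z :=
        fun x h0 h1 => intervalIntegral.integral_add_adjacent_intervals (hσL x h0 h1) (hσR x h0 h1)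
      have heqOn : EqOn (fun x => (∫ y in (B.y0 : ℝ)..c, ∫ z in (B.z0 : ℝ)..B.z1, f x y z) +
            ∫ y in (c : ℝ)..B.y1, ∫ z in (B.z0 : ℝ)..B.z1, f x y z)
          (fun x => ∫ y in (B.y0 : ℝ)..B.y1, ∫ z in (B.z0 : ℝ)..B.z1, f x y z) (uIcc (B.x0 : ℝ) B.x1) := by
        intro x hx
        rw [uIcc_of_le hxx] at hx
        exact hsec x hx.1 hx.2
      refine ⟨?_, ?_, fun x h0 h1 => (hσL x h0 h1).trans (hσR x h0 h1), ?_, hxL, hyL.trans hyR, hzL⟩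
      · rw [KdTree3.total, ← intervalIntegral.integral_congr heqOn, intervalIntegral.integral_add hIL hIR]
        exact MI.mem_add hmL hmR
      · exact (hIL.add hIR).congr fun x hx => heqOn (uIoc_subset_uIcc hx)
      · intro x y h0 h1 g0 g1
        rcases le_total y (c : ℝ) with hc | hc
        · exact hτL x y h0 h1 g0 hc
        · exact hτR x y h0 h1 hc g1
  | KdTree3.splitZ c L R, B, hok => by
      simp only [KdTree3.leaves, leafClaimsOK3, List.all_append, Bool.and_eq_true] at hok
      obtain ⟨hmL, hIL, hσL, hτL, hxL, hyL, hzL⟩ := tree3_sound hS hf hΨ L ⟨B.x0, B.x1, B.y0, B.y1, B.z0, c⟩ hok.1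
      obtain ⟨hmR, hIR, hσR, hτR, hxR, hyR, hzR⟩ := tree3_sound hS hf hΨ R ⟨B.x0, B.x1, B.y0, B.y1, c, B.z1⟩ hok.2
      simp only at hmL hIL hσL hτL hxL hyL hzL hmR hIR hσR hτR hxR hyR hzR
      have hxx : (B.x0 : ℝ) ≤ B.x1 := by exact_mod_cast hxL
      have hyy : (B.y0 : ℝ) ≤ B.y1 := by exact_mod_cast hyL
      -- innermost additivity on every `(x, y)`-section
      have hin : ∀ x y : ℝ, (B.x0 : ℝ) ≤ x → x ≤ B.x1 → (B.y0 : ℝ) ≤ y → y ≤ B.y1 →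
          (∫ z in (B.z0 : ℝ)..c, f x y z) + ∫ z in (c : ℝ)..B.z1, f x y z = ∫ z in (B.z0 : ℝ)..B.z1, f x y z :=
        fun x y h0 h1 g0 g1 =>
          intervalIntegral.integral_add_adjacent_intervals (hτL x y h0 h1 g0 g1) (hτR x y h0 h1 g0 g1)
      -- middle: on every `x`-section the `y`-integrands agree on `[y0, y1]`
      have hmidOn : ∀ x : ℝ, (B.x0 : ℝ) ≤ x → x ≤ B.x1 →
          EqOn (fun y => (∫ z in (B.z0 : ℝ)..c, f x y z) + ∫ z in (c : ℝ)..B.z1, f x y z)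
            (fun y => ∫ z in (B.z0 : ℝ)..B.z1, f x y z) (uIcc (B.y0 : ℝ) B.y1) := by
        intro x h0 h1 y hy
        rw [uIcc_of_le hyy] at hy
        exact hin x y h0 h1 hy.1 hy.2
      have hmid : ∀ x : ℝ, (B.x0 : ℝ) ≤ x → x ≤ B.x1 →
          (∫ y in (B.y0 : ℝ)..B.y1, ∫ z in (B.z0 : ℝ)..c, f x y z) +
              ∫ y in (B.y0 : ℝ)..B.y1, ∫ z in (c : ℝ)..B.z1, f x y z =
            ∫ y in (B.y0 : ℝ)..B.y1, ∫ z in (B.z0 : ℝ)..B.z1, f x y z := by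
        intro x h0 h1
        rw [← intervalIntegral.integral_add (hσL x h0 h1) (hσR x h0 h1)]
        exact intervalIntegral.integral_congr (hmidOn x h0 h1)
      have heqOn : EqOn (fun x => (∫ y in (B.y0 : ℝ)..B.y1, ∫ z in (B.z0 : ℝ)..c, f x y z) +
            ∫ y in (B.y0 : ℝ)..B.y1, ∫ z in (c : ℝ)..B.z1, f x y z)
          (fun x => ∫ y in (B.y0 : ℝ)..B.y1, ∫ z in (B.z0 : ℝ)..B.z1, f x y z) (uIcc (B.x0 : ℝ) B.x1) := by
        intro x hx
        rw [uIcc_of_le hxx] at hx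
        exact hmid x hx.1 hx.2
      refine ⟨?_, ?_, ?_, fun x y h0 h1 g0 g1 => (hτL x y h0 h1 g0 g1).trans (hτR x y h0 h1 g0 g1),
        hxL, hyL, hzL.trans hzR⟩
      · rw [KdTree3.total, ← intervalIntegral.integral_congr heqOn, intervalIntegral.integral_add hIL hIR]
        exact MI.mem_add hmL hmR
      · exact (hIL.add hIR).congr fun x hx => heqOn (uIoc_subset_uIcc hx)
      · intro x h0 h1
        exact ((hσL x h0 h1).add (hσR x h0 h1)).congr fun y hy => hmidOn x h0 h1 (uIoc_subset_uIcc hy)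

/-- **Kernel obligation for leaf `i`** (one `decide` each; vacuous past the last leaf).
[cite: MahboubiMelquiondSibutpinote2016, Sect. 3.3] [cite: MakinoBerz2003, Algorithm 2] -/
def leafCheckG3 (S : ℕ) (Ψ : ℚ → ℚ → ℚ → ℚ → ℚ → ℚ → EPrm → IPoly3 × Bool) (t : KdTree3) (B : Box3Q) (i : ℕ) :
    Bool :=
  match (t.leaves B)[i]? with
  | none => true
  | some l =>
      let e := leafEncl3 S Ψ l.1 l.2.1
      e.2 && decide (l.2.2.lo ≤ e.1.lo) && decide (e.1.hi ≤ l.2.2.hi)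

/-- **Final obligation**: positivity of `S`, leaf count at most `n`, sum of the claims inside `[lo·S, hi·S]`.
[cite: MahboubiMelquiondSibutpinote2016, Sect. 3.3] -/
def treeCheckG3 (S : ℕ) (t : KdTree3) (n : ℕ) (lo hi : ℚ) : Bool :=
  decide (0 < S) && decide (t.size ≤ n) && decide (lo * S ≤ (t.total.lo : ℚ)) && decide ((t.total.hi : ℚ) ≤ hi * S)

/-- [folklore] -/
private theorem leafClaimsOK3_of_leafCheckG3 (S : ℕ) (Ψ : ℚ → ℚ → ℚ → ℚ → ℚ → ℚ → EPrm → IPoly3 × Bool)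
    (t : KdTree3) (B : Box3Q) {n : ℕ} (hn : t.size ≤ n) (H : ∀ i : ℕ, i < n → leafCheckG3 S Ψ t B i = true) :
    leafClaimsOK3 S Ψ (t.leaves B) = true := by
  unfold leafClaimsOK3
  refine List.all_eq_true.2 fun l hl => ?_
  obtain ⟨i, hi, rfl⟩ := List.getElem_of_mem hl
  have hlt : i < n := lt_of_lt_of_le (by simpa [KdTree3.length_leaves] using hi) hn
  have := H i hlt
  simp only [leafCheckG3, List.getElem?_eq_getElem hi] at this
  exact this

/-- **Soundness of the generic adaptive 3-D certificate**. [cite: MakinoBerz2003, Algorithm 2]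
[cite: BerzMakino1999, Sect. 2] [cite: MahboubiMelquiondSibutpinote2016, Sect. 3.3] -/
theorem integral_bounds_of_leafCheckG3 {S : ℕ} {f : ℝ → ℝ → ℝ → ℝ}
    (hf : Measurable fun z : ℝ × ℝ × ℝ => f z.1 z.2.1 z.2.2)
    {Ψ : ℚ → ℚ → ℚ → ℚ → ℚ → ℚ → EPrm → IPoly3 × Bool}
    (hΨ : ∀ (h k l cx cy cz : ℚ) (P : EPrm), 0 < S → 0 ≤ h → 0 ≤ k → 0 ≤ l → (Ψ h k l cx cy cz P).2 = true →
      TMem3 S h k l (fun u v w => f ((cx : ℝ) + u) ((cy : ℝ) + v) ((cz : ℝ) + w)) (Ψ h k l cx cy cz P).1)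
    {t : KdTree3} {B : Box3Q} {n : ℕ} {lo hi : ℚ} (hleaf : ∀ i : ℕ, i < n → leafCheckG3 S Ψ t B i = true)
    (ht : treeCheckG3 S t n lo hi = true) :
    (lo : ℝ) ≤ ∫ x in (B.x0 : ℝ)..B.x1, ∫ y in (B.y0 : ℝ)..B.y1, ∫ z in (B.z0 : ℝ)..B.z1, f x y z ∧
      ∫ x in (B.x0 : ℝ)..B.x1, ∫ y in (B.y0 : ℝ)..B.y1, ∫ z in (B.z0 : ℝ)..B.z1, f x y z ≤ (hi : ℝ) := by
  unfold treeCheckG3 at ht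
  simp only [Bool.and_eq_true, decide_eq_true_eq] at ht
  obtain ⟨⟨⟨hS, hn⟩, hlo⟩, hhi⟩ := ht
  have hsound : ModelSound3 S f Ψ := fun h k l cx cy cz P h0 k0 l0 hok => hΨ h k l cx cy cz P hS h0 k0 l0 hok
  obtain ⟨⟨h1, h2⟩, -⟩ := tree3_sound hS hf hsound t B (leafClaimsOK3_of_leafCheckG3 S Ψ t B hn hleaf)
  have hSr : (0 : ℝ) < S := by exact_mod_cast hS
  have hloR : (lo : ℝ) * S ≤ (t.total.lo : ℝ) := by exact_mod_cast hlo
  have hhiR : (t.total.hi : ℝ) ≤ (hi : ℝ) * S := by exact_mod_cast hhi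
  exact ⟨le_of_mul_le_mul_right (hloR.trans h1) hSr, le_of_mul_le_mul_right (h2.trans hhiR) hSr⟩

/-! ### Part B. Adaptive certificates for `BExpr3` integrands -/

/-- Kernel obligation for leaf `i`, `BExpr3` integrand. [cite: MahboubiMelquiondSibutpinote2016, Sect. 3.3] -/
def leafCheck3E (S : ℕ) (E : BExpr3) (t : KdTree3) (B : Box3Q) (i : ℕ) : Bool :=
  leafCheckG3 S (fun h k l cx cy cz P => BExpr3.model S h k l P cx cy cz E) t B i

/-- Final obligation, `BExpr3` integrand (`= treeCheckG3`). [cite: MahboubiMelquiondSibutpinote2016, Sect. 3.3] -/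
def treeCheck3E (S : ℕ) (t : KdTree3) (n : ℕ) (lo hi : ℚ) : Bool := treeCheckG3 S t n lo hi

/-- **Soundness of the adaptive certificate for `BExpr3` integrands** (no side hypotheses).
[cite: MakinoBerz2003, Algorithm 2] [cite: BerzMakino1999, Sect. 2] [cite: MahboubiMelquiondSibutpinote2016, Sect. 3.3] -/
theorem integral_bounds_of_leafCheck3E {S : ℕ} {E : BExpr3} {t : KdTree3} {B : Box3Q} {n : ℕ} {lo hi : ℚ}
    (hleaf : ∀ i : ℕ, i < n → leafCheck3E S E t B i = true) (ht : treeCheck3E S t n lo hi = true) :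
    (lo : ℝ) ≤ ∫ x in (B.x0 : ℝ)..B.x1, ∫ y in (B.y0 : ℝ)..B.y1, ∫ z in (B.z0 : ℝ)..B.z1, E.toFun₃ x y z ∧
      ∫ x in (B.x0 : ℝ)..B.x1, ∫ y in (B.y0 : ℝ)..B.y1, ∫ z in (B.z0 : ℝ)..B.z1, E.toFun₃ x y z ≤ (hi : ℝ) :=
  integral_bounds_of_leafCheckG3 (BExpr3.measurable_toFun₃ E)
    (fun _ _ _ cx cy cz P hS h0 k0 l0 hok => BExpr3.tmem3_model hS h0 k0 l0 P cx cy cz E hok) hleaf ht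

/-! ### Part C. A refinement heuristic (proposes a tree; soundness-free) -/

/-- **Refinement by bisection of the longest side** while the box enclosure is rejected or wider than `tol` (scaled by
`S`), at most `depth` times along any branch; leaves get parameters `P` and their computed enclosures as claims.  A
PROPOSAL only — certified by `leafCheck3E` / `treeCheck3E`. [cite: MahboubiMelquiondSibutpinote2016, Sect. 3.3] -/
def kdRefine3 (S : ℕ) (E : BExpr3) (P : EPrm) (tol : ℤ) : ℕ → Box3Q → KdTree3
  | 0, B => KdTree3.leaf P (leafEncl3 S (fun h k l cx cy cz P => BExpr3.model S h k l P cx cy cz E) B P).1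
  | d + 1, B =>
      let e := leafEncl3 S (fun h k l cx cy cz P => BExpr3.model S h k l P cx cy cz E) B P
      if e.2 && decide (e.1.hi - e.1.lo ≤ tol) then KdTree3.leaf P e.1
      else
        let wx := B.x1 - B.x0
        let wy := B.y1 - B.y0
        let wz := B.z1 - B.z0
        if wy ≤ wx ∧ wz ≤ wx then
          let c := (B.x0 + B.x1) / 2
          KdTree3.splitX c (kdRefine3 S E P tol d ⟨B.x0, c, B.y0, B.y1, B.z0, B.z1⟩)
            (kdRefine3 S E P tol d ⟨c, B.x1, B.y0, B.y1, B.z0, B.z1⟩)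
        else if wz ≤ wy then
          let c := (B.y0 + B.y1) / 2
          KdTree3.splitY c (kdRefine3 S E P tol d ⟨B.x0, B.x1, B.y0, c, B.z0, B.z1⟩)
            (kdRefine3 S E P tol d ⟨B.x0, B.x1, c, B.y1, B.z0, B.z1⟩)
        else
          let c := (B.z0 + B.z1) / 2
          KdTree3.splitZ c (kdRefine3 S E P tol d ⟨B.x0, B.x1, B.y0, B.y1, B.z0, c⟩)
            (kdRefine3 S E P tol d ⟨B.x0, B.x1, B.y0, B.y1, c, B.z1⟩)

end PolyMP

end Literature.Analysis.ValidatedNumerics
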